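/-
Copyright (c) 2026 the pub-hodgecm-mathlib formalisation cell (harness21).  Prover seat hodgecm-mathlib-LH4-p01 (g9), F3-3 pen (dealer LH4-plan (g8) DEAL g8-#19c, WORD #69;
route (B) F3 «TOT-Λ by over-orders»), heir LEAD F0P3a-plan (g16), 2026-09-02.  FILE 2 of 2 (the generator); FILE 1 = `GluedOverOrderLevelLaw`.
-/
import Literature.NumberTheory.Automorphic.GluedOverOrderLevelLaw   -- FILE 1 (this seat): `exists_normOne_coord`, `exists_normOne_sub_mem_span`, the level law `char_and_valuation_eq_of_odd_level` ∕ `_even_level`, valuation bookkeeping; brings ★ (L3′) `relIndex_units_comap_norm_eq_eisenstein`, (L2′) `mem_range_eval₂_iff_eisenstein`, `lam_sq_eq_eisenstein`, ★ [T2-c] `coord_unique`, ★ O1 `span_singleton_eq_span_uniformizer_pow_of_valuation_eq`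
import HarnessLib

/-!
# Every good glued over-order has a DEEP UNITARY GENERATOR: `G(N″, b, ιy) = 𝒪_E[(u′, λ′)]` with `(u′, λ′)·(u′, λ′)⋆ = 1`, exponents `(N″, b)`
# (Rogawski 1990 §4.9; Neukirch I §12; Serre, Corps locaux I §6, V §2, X §1)

Topic `NumberTheory/Automorphic`; namespace `Literature.NumberTheory.Automorphic`.  THEOREMS ONLY (no definition, no instance, no notation, no named fact, no `sorry`);
(D0) currency of ★ (L3′) `QuadraticEisensteinOrderNormIndex` = ★ F3-1 `GluedOverOrders` (two valued fields `F → E` — the inert dictionary `ιO σO` —, the Eisenstein quadratic ring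
`O₁ = j𝒪_E ⊕ j𝒪_E θ`, `θ² = j(ιO a)θ + j(ιO k)`, with an involution `σ₁` over `σO` fixing `θ`).  Cell `pub/hodgecm-mathlib` (D-0151), crux H413 = `stmt-HodgeConjecture-24833`; M6 road
«TOT-Λ», route (B) «by over-orders» (dealer LH4-plan (g8) WORD #69, F3-0 FIT by LH7-p04 (g11), law memo `F0/P3c/LH4/LH4-p01/g9/o4/f3/F3-LAW.v1`), file F3-3 per SIG-F3-3 eaa558e6 (the RE-CUT:
the unit index `[C_O : O^×] = (q+1)q^{N″+b−1}` of a good over-order is ★ (L3′) BY NAME once the over-order is shown to be `𝒪_E[x′]` for a deep UNITARY `x′` of exponents `(N″, b)`).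
HONEST LABEL: HC_CM is proved only modulo the 7 printed citations (2 remaining named inputs: hLiu418 = stmt-HodgeConjecture-24832, h413 = stmt-HodgeConjecture-24833) until rung 0
closes; commutative algebra, count-neutral (pays no organ, opens no road).

THE MATHEMATICS.  `Λ = 𝒪_E × O₁`, `⋆ = (σO, σ₁)`, `Π_{N″} = j(ϖ^{N″})θ` the Eisenstein generator of `O_{N″} = j𝒪_E ⊕ j𝒪_E Π_{N″}`, and ★ F3-1's glued over-order
`G(N″, b, c′) = {(y, j b₀ + j c₀ Π_{N″}) : y ≡ b₀ + c₀ c′ (ϖ^b)}`.  §1: with the unit different `ξ` (`ξ − σO ξ ∈ 𝒪_E^×`), `z := 1 + j(ξϖ^{N″})θ ∈ O_{N″}^×` and `λ′ := z ∕ σ₁ z =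
j p′ + j q′ θ` is UNITARY (`λ′·σ₁λ′ = 1`) with `q′·ν = (ξ − σO ξ)ϖ^{N″}` for a unit `ν` and `p′ ≡ 1` — a norm-one generator of `O_{N″}` with θ-coordinate of EXACT valuation `N″`.
§2: Hilbert 90 at level `b`: a unit `c` with `c·σO c ≡ 1 (ϖ^b)` is congruent mod `ϖ^b` to an exact norm-one `u′` (from the binder «norms from `U_E^{(b)}` onto `U_F^{(b)}`», unramified).
§3: for a HERMITIAN character value `c′ = ιO y` at a MONOGENIC level (`b = 2M` with `ord y = M ≤ N″`, or `b = 2N″+1` with `ord y ≥ N″+1`) the class `c* := p′ + ε·ιO y`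
(`ε = q′∕ϖ^{N″}`) is norm-one mod `ϖ^b` (unitarity of `λ′` + the character congruence), so §2 gives a unitary `u′ ≡ c*`; then `x′ := (u′, λ′)` is DEEP and UNITARY, its glue depth
`ord(u′² − t′u′ + D′) = ord f_{N″}(u′ − p′)∕ε)` is EXACTLY `b` (value law; the level pins it), and **`𝒪_E[x′] = G(N″, b, ιO y)`** (§4, double inclusion through ★ (L2′)'s three-term
normal form — the `⊇` half divides by the exact-level element `χ(u′) ∈ ϖ^b 𝒪_E^×`).  §5: hence ★ (L3′) gives `[C_G : G^×] = (#𝓀_F + 1)·#𝓀_F^{N″+b−1}` for EVERY good glued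
over-order with `b ≥ 1` — Rogawski's `(q+1)q^{N+n−1}` one level down, no `|2| = 1`, no parity binder (T14-66 KILL clause honoured: the generator comes from `ξ` and Hilbert 90, never
from `½`).  [cite: Rogawski1990, §4.9 Lemma 4.9.3 p. 56, Prop. 4.9.1 (b) p. 55] [cite: Neukirch1999, Ch. I §12] [cite: SerreLocalFields1979, Ch. I §6 Prop. 17–18; Ch. V §2 Prop. 3; Ch. X §1]

## References
* [Rogawski1990] J. D. Rogawski, *Automorphic Representations of Unitary Groups in Three Variables*, Ann. of Math. Stud. 123 (1990): §4.9 Lemma 4.9.3 p. 56, Prop. 4.9.1 (b) p. 55.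
* [Neukirch1999] J. Neukirch, *Algebraic Number Theory*, Grundlehren 322 (1999): Ch. I §12 (orders, conductors, fibre products of orders).
* [SerreLocalFields1979] J.-P. Serre, *Local Fields*, GTM 67 (1979): Ch. I §6 Prop. 17–18 (Eisenstein equations); Ch. V §2 Prop. 3 + Cor. (norms of the unit filtration at an
  unramified extension); Ch. X §1 (Hilbert 90).
* [Jacobowitz1962] R. Jacobowitz, *Hermitian forms over local fields*, Amer. J. Math. 84 (1962): §4, §7 (lattices of an order as a units-torsor).
-/

set_option autoImplicit false

noncomputable section

open scoped ValuativeRel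
open Polynomial ValuativeRel

namespace Literature.NumberTheory.Automorphic

variable {F E : Type*} [Field F] [ValuativeRel F] [Field E] [ValuativeRel E] {O₁ : Type*} [CommRing O₁]
  (ιO : 𝒪[F] →+* 𝒪[E]) (σO : 𝒪[E] →+* 𝒪[E]) (j : 𝒪[E] →+* O₁) (σ₁ : O₁ →+* O₁) (θ : O₁) {aF k₀F : 𝒪[F]}

/-! ## §4 THE DEEP UNITARY GENERATOR of a good glued over-order -/

/-- **(UG) EVERY GOOD GLUED OVER-ORDER HAS A DEEP UNITARY GENERATOR.**  In the Eisenstein frame of ★ F3-1 ∕ ★ (L3′) (`θ² = j(ιO a)θ + j(ιO k)`, `a ∈ 𝔪_F`, `k` a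
uniformiser class, `σ₁ θ = θ`, unit different `ξ`, uniformisers `ιO ϖ_F = ϖ`), with the level-`b` norm surjectivity `hnormEb` («`N(U_E^{(b)}) = U_F^{(b)}`», unramified) as the
only arithmetic binder: for a HERMITIAN character value `ιO y` at a MONOGENIC level — `b = 2N″+1` with `y ∈ (ϖ_F^{N″+1})`, or `b = 2M`, `1 ≤ M ≤ N″`, `y ∈ (ϖ_F^M) ∖ (ϖ_F^{M+1})` —
there are `u′ p′ q′ t′ D′ ∈ 𝒪_E` such that, with `λ′ := j p′ + j q′ θ`:
(i) `(u′, λ′)·(u′, λ′)⋆ = 1` (UNITARY); (ii) `u′ ≡ 1`, `p′ ≡ 1`, `1 − t′ + D′ ∈ 𝔪`, `λ′² − t′λ′ + D′ = 0` (DEEP + the quadratic relation);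
(iii) `v(q′) = v(ϖ)^{N″}`, `v(u′² − t′u′ + D′) = v(ϖ)^b` (EXPONENTS `(N″, b)`); (iv) `𝒪_E[(u′, λ′)] = G(N″, b, ιO y)` as sets (★ F3-1's glued over-order, token for token).
Hence ★ (L3′) `relIndex_units_comap_norm_eq_eisenstein` applies to `G(N″, b, ιO y)` BY NAME: `[C_G : G^×] = (#𝓀_F + 1)·#𝓀_F^{N″+b−1}` — and so do ★ [T2-a] (the torsor) and the ★ F4
parity heads (the gate) at `τ′ := φ(u′, λ′)`.  No `|2| = 1`, no parity binder.
[cite: Rogawski1990, §4.9 Lemma 4.9.3 p. 56, Prop. 4.9.1 (b) p. 55] [cite: Neukirch1999, Ch. I §12] [cite: SerreLocalFields1979, Ch. I §6 Prop. 17–18; Ch. V §2 Prop. 3; Ch. X §1] -/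
theorem exists_unitary_generator_glued (hσσ : ∀ x, σO (σO x) = x) (hσι : ∀ y, σO (ιO y) = ιO y) (hιu : ∀ y, IsUnit (ιO y) → IsUnit y)
    (hσ₁j : ∀ x, σ₁ (j x) = j (σO x)) (hσ₁θ : σ₁ θ = θ)
    (hθ : θ ^ 2 = j (ιO aF) * θ + j (ιO k₀F)) (haF : aF ∈ IsLocalRing.maximalIdeal 𝒪[F]) (hk₀ : k₀F ∈ IsLocalRing.maximalIdeal 𝒪[F])
    (hcoord : ∀ z : O₁, ∃! bc : 𝒪[E] × 𝒪[E], z = j bc.1 + j bc.2 * θ)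
    {ϖF : F} {ϖ : E} (hϖF : IsUniformizingElement ϖF) (hϖ : IsUniformizingElement ϖ) (hιϖ : ιO ⟨ϖF, hϖF.mem⟩ = ⟨ϖ, hϖ.mem⟩)
    (hk₁ : valuation E ((ιO k₀F : 𝒪[E]) : E) = valuation E ϖ) {ξ : 𝒪[E]} (hξ : IsUnit (ξ - σO ξ)) {b : ℕ}
    (hnormEb : ∀ r : 𝒪[E], σO r = r → r - 1 ∈ Ideal.span ({(⟨ϖ, hϖ.mem⟩ : 𝒪[E]) ^ b} : Set 𝒪[E]) →
      ∃ w : 𝒪[E], w - 1 ∈ Ideal.span ({(⟨ϖ, hϖ.mem⟩ : 𝒪[E]) ^ b} : Set 𝒪[E]) ∧ w * σO w = r)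
    {N'' : ℕ} {y : 𝒪[F]}
    (hlvl : (b = 2 * N'' + 1 ∧ y ∈ Ideal.span ({(⟨ϖF, hϖF.mem⟩ : 𝒪[F]) ^ (N'' + 1)} : Set 𝒪[F])) ∨
      ∃ M : ℕ, 1 ≤ M ∧ M ≤ N'' ∧ b = 2 * M ∧ y ∈ Ideal.span ({(⟨ϖF, hϖF.mem⟩ : 𝒪[F]) ^ M} : Set 𝒪[F]) ∧
        y ∉ Ideal.span ({(⟨ϖF, hϖF.mem⟩ : 𝒪[F]) ^ (M + 1)} : Set 𝒪[F])) :
    ∃ u' p' q' t' D' : 𝒪[E],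
      ((u', j p' + j q' * θ) : 𝒪[E] × O₁) * RingHom.prodMap σO σ₁ (u', j p' + j q' * θ) = 1 ∧
      u' - 1 ∈ IsLocalRing.maximalIdeal 𝒪[E] ∧ p' - 1 ∈ IsLocalRing.maximalIdeal 𝒪[E] ∧ 1 - t' + D' ∈ IsLocalRing.maximalIdeal 𝒪[E] ∧
      (j p' + j q' * θ) ^ 2 - j t' * (j p' + j q' * θ) + j D' = 0 ∧
      valuation E ((q' : 𝒪[E]) : E) = valuation E ϖ ^ N'' ∧
      valuation E ((u' * u' - t' * u' + D' : 𝒪[E]) : E) = valuation E ϖ ^ b ∧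
      ((Polynomial.eval₂RingHom (RingHom.prod (RingHom.id 𝒪[E]) j) ((u', j p' + j q' * θ) : 𝒪[E] × O₁)).range : Set (𝒪[E] × O₁)) =
        {z : 𝒪[E] × O₁ | ∃ b₀ c₀ : 𝒪[E], z.2 = j b₀ + j c₀ * (j ((⟨ϖ, hϖ.mem⟩ : 𝒪[E]) ^ N'') * θ) ∧
          z.1 - (b₀ + c₀ * ιO y) ∈ Ideal.span {(⟨ϖ, hϖ.mem⟩ : 𝒪[E]) ^ b}} := by
  -- ### 0. the frame
  set π : 𝒪[E] := ⟨ϖ, hϖ.mem⟩ with hπdef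
  set a : 𝒪[E] := ιO aF with hadef
  set k : 𝒪[E] := ιO k₀F with hkdef
  set c' : 𝒪[E] := ιO y with hc'def
  set I : Ideal 𝒪[E] := Ideal.span ({π ^ b} : Set 𝒪[E]) with hI
  have hπv : valuation E ((π : 𝒪[E]) : E) = valuation E ϖ := rfl
  have ha : a ∈ IsLocalRing.maximalIdeal 𝒪[E] := map_k₀_mem_maximalIdeal ιO hιu haF
  have hk : k ∈ IsLocalRing.maximalIdeal 𝒪[E] := map_k₀_mem_maximalIdeal ιO hιu hk₀
  have hσπ : σO π = π := by rw [← hιϖ, hσι]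
  have hσc' : σO c' = c' := hσι y
  have hπ0 : π ≠ 0 := hϖ.coe_ne_zero
  have hb1 : 1 ≤ b := by rcases hlvl with ⟨hb, -⟩ | ⟨M, hM1, -, hb, -⟩ <;> omega
  have hIm : I ≤ IsLocalRing.maximalIdeal 𝒪[E] := span_uniformizer_pow_le_maximalIdeal hϖ hb1
  -- the level data: Char, the exact-valuation law, and `c′ ∈ 𝔪`
  have hlev : c' * c' - (π ^ N'' * a * c' + π ^ (2 * N'') * k) ∈ I ∧
      (∀ x : 𝒪[E], x - c' ∈ I → valuation E ((x * x - π ^ N'' * a * x - π ^ (2 * N'') * k : 𝒪[E]) : E) = valuation E ϖ ^ b) ∧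
      c' ∈ IsLocalRing.maximalIdeal 𝒪[E] := by
    rcases hlvl with ⟨hb, hy⟩ | ⟨M, hM1, hMN, hb, hyM, hyM1⟩
    · subst hb
      have hc'm : c' ∈ Ideal.span ({π ^ (N'' + 1)} : Set 𝒪[E]) := map_mem_span_pow_of_mem_span_pow ιO hϖF hϖ hιϖ hy
      obtain ⟨h1, h2⟩ := char_and_valuation_eq_of_odd_level hϖ ha hk₁ hc'm
      exact ⟨h1, h2, span_uniformizer_pow_le_maximalIdeal hϖ (by omega) hc'm⟩
    · subst hb
      have hc'v : valuation E (c' : E) = valuation E ϖ ^ M := valuation_map_eq_of_mem_span_of_not_mem ιO hϖF hϖ hιϖ hyM hyM1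
      obtain ⟨h1, h2⟩ := char_and_valuation_eq_of_even_level hϖ ha hk hM1 hMN hc'v
      exact ⟨h1, h2, span_uniformizer_pow_le_maximalIdeal hϖ hM1 (mem_span_uniformizer_pow_of_valuation_eq hϖ hc'v)⟩
  obtain ⟨hchar, hval, hc'm⟩ := hlev
  -- ### 1. the norm-one `λ′ = j p′ + j q′ θ` of conductor `N″`
  obtain ⟨p', q', ν, hνu, hp1, hqν, hnorm1⟩ := exists_normOne_coord ιO σO j σ₁ θ hσσ hιu hσ₁j hσ₁θ hθ haF hk₀ hcoord hσπ ξ N''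
  set L : O₁ := j p' + j q' * θ with hL
  obtain ⟨νU, hνU⟩ := hνu
  set ε : 𝒪[E] := (ξ - σO ξ) * ↑νU⁻¹ with hεdef
  have hεu : IsUnit ε := hξ.mul (Units.isUnit νU⁻¹)
  obtain ⟨εU, hεU⟩ := hεu
  have hεinv : ε * ↑εU⁻¹ = 1 := by rw [← hεU, Units.mul_inv]
  have hvε : valuation E (ε : E) = 1 := valuation_coe_eq_one_of_isUnit (hεU ▸ εU.isUnit)
  have hq' : q' = ε * π ^ N'' := by
    calc q' = q' * ν * ↑νU⁻¹ := by rw [← hνU, mul_assoc, Units.mul_inv, mul_one]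
      _ = ε * π ^ N'' := by rw [hqν, hεdef]; ring
  -- coordinates of `λ′·σ₁λ′ = 1`: (E1) `p′σp′ + q′σq′k = 1`, (E2) `p′σq′ + q′σp′ + q′σq′a = 0`
  have hσlam : σ₁ L = j (σO p') + j (σO q') * θ := by rw [hL, map_add, map_mul, hσ₁j, hσ₁j, hσ₁θ]
  have hE := hnorm1
  rw [hσlam, hL, coord_mul_eisenstein j θ hθ p' q' (σO p') (σO q'), show (1 : O₁) = j 1 + j 0 * θ by simp] at hE
  obtain ⟨hE1, hE2⟩ := coord_unique j θ hcoord hE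
  have hσq' : σO q' = σO ε * π ^ N'' := by rw [hq', map_mul, map_pow, hσπ]
  rw [hσq', hq'] at hE1 hE2
  -- ### 2. the norm-one residue `c* = p′ + ε c′` and its Hilbert-90 lift `u′`
  set cs : 𝒪[E] := p' + ε * c' with hcs
  have hcsu : IsUnit cs :=
    isUnit_of_sub_one_mem_maximalIdeal (by rw [hcs, show p' + ε * c' - 1 = (p' - 1) + ε * c' by ring]; exact Ideal.add_mem _ hp1 (Ideal.mul_mem_left _ _ hc'm))
  have hcsnorm : cs * σO cs - 1 ∈ I := by
    -- `c*σc* − 1 = εσε·(c′² − ϖ^{N″}a c′ − ϖ^{2N″}k)` by (E1), (E2)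
    have hE2' : p' * σO ε + ε * σO p' = -(ε * σO ε * π ^ N'' * a) := by
      have h : π ^ N'' * (p' * σO ε + ε * σO p' + ε * σO ε * π ^ N'' * a) = 0 := by linear_combination hE2
      have h' := (mul_eq_zero.1 h).resolve_left (pow_ne_zero _ hπ0)
      linear_combination h'
    have key : cs * σO cs - 1 = ε * σO ε * (c' * c' - (π ^ N'' * a * c' + π ^ (2 * N'') * k)) := by
      rw [hcs, map_add, map_mul, hσc']
      linear_combination hE1 + c' * hE2'
    rw [key]
    exact Ideal.mul_mem_left _ _ hchar
  obtain ⟨u', hu'n, hu'c⟩ := exists_normOne_sub_mem_span σO hσσ hnormEb hcsu hcsnorm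
  have hδ : u' - p' - ε * c' ∈ I := by
    have : u' - p' - ε * c' = u' - cs := by rw [hcs]; ring
    rw [this]; exact hu'c
  -- ### 3. the data `t′ = 2p′ + a q′`, `D′ = p′² + a p′q′ − q′²k`, and the exact level of `χ(u′) = u′² − t′u′ + D′`
  set t' : 𝒪[E] := 2 * p' + a * q' with ht'
  set D' : 𝒪[E] := p' * p' + a * p' * q' - q' * q' * k with hD'
  have hlam2 : L ^ 2 - j t' * L + j D' = 0 := by
    rw [hL, sq, coord_mul_eisenstein j θ hθ p' q' p' q', ht', hD']
    simp only [map_add, map_mul, map_sub, map_ofNat]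
    ring
  have hχ : u' * u' - t' * u' + D' = (u' - p') * (u' - p') - a * q' * (u' - p') - q' * q' * k := by rw [ht', hD']; ring
  have hn : valuation E ((u' * u' - t' * u' + D' : 𝒪[E]) : E) = valuation E ϖ ^ b := by
    -- `χ(u′) = ε²·f(x)`, `x = c′ + ε⁻¹(u′ − c*) ≡ c′ (mod ϖ^b)`
    set x : 𝒪[E] := c' + ↑εU⁻¹ * (u' - cs) with hx
    have hxI : x - c' ∈ I := by rw [hx, add_sub_cancel_left]; exact Ideal.mul_mem_left _ _ hu'c
    have hεx : ε * x = u' - p' := by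
      rw [hx, mul_add, ← mul_assoc, hεinv, one_mul, hcs]; ring
    have hfac : u' * u' - t' * u' + D' = ε * ε * (x * x - π ^ N'' * a * x - π ^ (2 * N'') * k) := by
      rw [hχ, ← hεx, hq']; ring
    have hfx := hval x hxI
    rw [hfac, Subring.coe_mul, Subring.coe_mul, map_mul, map_mul, hvε, one_mul, one_mul, hfx]
  have hχI : u' * u' - t' * u' + D' ∈ I := mem_span_uniformizer_pow_of_valuation_eq hϖ hn
  have hsq : L ^ 2 = j (t' * p' - D') + j (t' * q') * θ := lam_sq_eq_eisenstein j θ hL hlam2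
  refine ⟨u', p', q', t', D', ?_, ?_, hp1, ?_, hlam2, ?_, hn, ?_⟩
  · -- (i) unitary
    refine Prod.ext ?_ ?_
    · change u' * σO u' = 1; exact hu'n
    · change L * σ₁ L = 1; exact hnorm1
  · -- (ii) `u′ ≡ 1`
    have : u' - 1 = (u' - p' - ε * c') + ((p' - 1) + ε * c') := by ring
    rw [this]
    exact Ideal.add_mem _ (hIm hδ) (Ideal.add_mem _ hp1 (Ideal.mul_mem_left _ _ hc'm))
  · -- (ii) `χ(1) = 1 − t′ + D′ ∈ 𝔪`
    have : 1 - t' + D' = (p' - 1) * (p' - 1) + a * (q' * (p' - 1)) - q' * q' * k := by rw [ht', hD']; ring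
    rw [this]
    exact Ideal.sub_mem _ (Ideal.add_mem _ (Ideal.mul_mem_left _ _ hp1) (Ideal.mul_mem_right _ _ ha)) (Ideal.mul_mem_left _ _ hk)
  · -- (iii) `v(q′) = v(ϖ)^{N″}`
    rw [hq', Subring.coe_mul, SubmonoidClass.coe_pow, map_mul, map_pow, hvε, one_mul, hπv]
  · -- (iv) `𝒪_E[(u′, λ′)] = G(N″, b, c′)`
    ext z
    rw [SetLike.mem_coe, mem_range_eval₂_iff_eisenstein j u' hlam2 z]
    constructor
    · -- `⊆`: `z = Σ (cᵢ, j cᵢ) x′^i`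
      rintro ⟨c, rfl⟩
      refine ⟨c 0 + c 1 * p' + c 2 * (t' * p' - D'), (c 1 + c 2 * t') * ε, ?_, ?_⟩
      · simp only [Prod.snd_add, Prod.snd_mul, Prod.pow_snd, hsq]
        rw [hL, hq']
        simp only [map_add, map_mul, map_sub, map_pow]
        ring
      · simp only [Prod.fst_add, Prod.fst_mul, Prod.pow_fst]
        have key : c 0 + c 1 * u' + c 2 * u' ^ 2 - (c 0 + c 1 * p' + c 2 * (t' * p' - D') + (c 1 + c 2 * t') * ε * c') =
            c 1 * (u' - p' - ε * c') + c 2 * ((u' * u' - t' * u' + D') + t' * (u' - p' - ε * c')) := by ring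
        rw [key]
        exact Ideal.add_mem _ (Ideal.mul_mem_left _ _ hδ) (Ideal.mul_mem_left _ _ (Ideal.add_mem _ hχI (Ideal.mul_mem_left _ _ hδ)))
    · -- `⊇`: solve for `c₂` by dividing by the exact-level element `χ(u′)`
      rintro ⟨b₀, c₀, hz2, hz1⟩
      obtain ⟨r, hr⟩ := Ideal.mem_span_singleton'.1 hz1
      -- `c₂·χ(u′) = rϖ^b − c₀ε⁻¹(u′ − c*)`
      have hrhs : r * π ^ b - c₀ * ↑εU⁻¹ * (u' - cs) ∈ Ideal.span ({u' * u' - t' * u' + D'} : Set 𝒪[E]) := by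
        rw [span_singleton_eq_span_uniformizer_pow_of_valuation_eq hϖ hn]
        exact Ideal.sub_mem _ (Ideal.mul_mem_left _ _ (Ideal.mem_span_singleton_self _)) (Ideal.mul_mem_left _ _ hu'c)
      obtain ⟨c₂, hc₂⟩ := Ideal.mem_span_singleton'.1 hrhs
      set c₁ : 𝒪[E] := c₀ * ↑εU⁻¹ - c₂ * t' with hc₁
      set cc : 𝒪[E] := b₀ - c₁ * p' - c₂ * (t' * p' - D') with hcc
      refine ⟨![cc, c₁, c₂], Prod.ext ?_ ?_⟩
      · -- first coordinate: `cc + c₁u′ + c₂u′² = b₀ + c₀c′ + rϖ^b = z.1`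
        simp only [Prod.fst_add, Prod.fst_mul, Prod.pow_fst, Matrix.cons_val_zero, Matrix.cons_val_one, Matrix.cons_val_two,
          Matrix.head_cons, Matrix.tail_cons]
        have hz1' : z.1 = b₀ + c₀ * c' + r * π ^ b := by linear_combination (-1 : 𝒪[E]) * hr
        have hcsu' : u' - cs = (u' - p') - ε * c' := by rw [hcs]; ring
        rw [hz1', hcc, hc₁]
        rw [hcsu'] at hc₂
        linear_combination (-1 : 𝒪[E]) * hc₂ - c₀ * c' * hεinv
      · -- second coordinate: `j cc + j c₁ λ′ + j c₂ λ′² = j b₀ + j c₀ Π`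
        simp only [Prod.snd_add, Prod.snd_mul, Prod.pow_snd, Matrix.cons_val_zero, Matrix.cons_val_one, Matrix.cons_val_two,
          Matrix.head_cons, Matrix.tail_cons, hsq]
        rw [hz2, hcc, hc₁, hL, hq']
        simp only [map_mul, map_sub, map_pow]
        have hj : j ε * j (↑εU⁻¹ : 𝒪[E]) = 1 := by rw [← map_mul, hεinv, map_one]
        linear_combination (-(j c₀ * j π ^ N'' * θ)) * hj


/-! ## §5 COROLLARY: the unit index of a good glued over-order is ★ (L3′)'s `(q + 1)·q^{N″+b−1}` -/

/-- **THE OVER-ORDER UNIT INDEX `[C_G : G^×] = (q + 1)·q^{N″+b−1}`** for EVERY good glued over-order `G = G(N″, b, ιO y)` (`b ≥ 1` at a monogenic level, hermitian character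
value `ιO y`): by (UG) `G = 𝒪_E[(u′, λ′)]` with `(u′, λ′)` deep, unitary, of exponents `(N″, b)`, so ★ (L3′) `relIndex_units_comap_norm_eq_eisenstein` applies BY NAME (its frame
binders `hfixO hιinj hnormE hnorm₁ hq` — fixed ring, unit norms onto, `q_E = q_F²` — are passed through).  This is Rogawski's `(q+1)q^{N+n−1}` (★ [T2-c] ∕ (D5) at `O = R`) for ALL the
over-orders of route (B), tame and wild rows alike; the boundary `b = 0` (product orders, `q^{N″}`) is the separate plane count.  Packaged as: `∃ u′ p′ q′` with the set identity, the
unitarity, and the index.  [cite: Rogawski1990, §4.9 Lemma 4.9.3 p. 56, Prop. 4.9.1 (b) p. 55] [cite: Jacobowitz1962, §7] [cite: Neukirch1999, Ch. I §12] [cite: SerreLocalFields1979, Ch. V §2 Prop. 3] -/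
theorem exists_generator_relIndex_units_comap_norm_glued_eq [Finite 𝓀[F]] [Finite 𝓀[E]] [IsDiscreteValuationRing 𝒪[E]]
    (hσσ : ∀ x, σO (σO x) = x) (hσι : ∀ y, σO (ιO y) = ιO y) (hfixO : ∀ x, σO x = x → ∃ y, ιO y = x) (hιinj : Function.Injective ιO)
    (hιu : ∀ y, IsUnit (ιO y) → IsUnit y) (hσ₁j : ∀ x, σ₁ (j x) = j (σO x)) (hσ₁θ : σ₁ θ = θ)
    (hθ : θ ^ 2 = j (ιO aF) * θ + j (ιO k₀F)) (haF : aF ∈ IsLocalRing.maximalIdeal 𝒪[F]) (hk₀ : k₀F ∈ IsLocalRing.maximalIdeal 𝒪[F])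
    (hcoord : ∀ z : O₁, ∃! bc : 𝒪[E] × 𝒪[E], z = j bc.1 + j bc.2 * θ)
    (hnormE : ∀ b : 𝒪[E], IsUnit b → σO b = b → ∃ c : 𝒪[E], c * σO c = b) (hnorm₁ : ∀ z : O₁, IsUnit z → σ₁ z = z → ∃ w : O₁, w * σ₁ w = z)
    {ϖF : F} {ϖ : E} (hϖF : IsUniformizingElement ϖF) (hϖ : IsUniformizingElement ϖ) (hιϖ : ιO ⟨ϖF, hϖF.mem⟩ = ⟨ϖ, hϖ.mem⟩)
    (hk₁ : valuation E ((ιO k₀F : 𝒪[E]) : E) = valuation E ϖ) (hq : Nat.card 𝓀[E] = Nat.card 𝓀[F] ^ 2) {ξ : 𝒪[E]} (hξ : IsUnit (ξ - σO ξ)) {b : ℕ}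
    (hnormEb : ∀ r : 𝒪[E], σO r = r → r - 1 ∈ Ideal.span ({(⟨ϖ, hϖ.mem⟩ : 𝒪[E]) ^ b} : Set 𝒪[E]) →
      ∃ w : 𝒪[E], w - 1 ∈ Ideal.span ({(⟨ϖ, hϖ.mem⟩ : 𝒪[E]) ^ b} : Set 𝒪[E]) ∧ w * σO w = r)
    {N'' : ℕ} {y : 𝒪[F]}
    (hlvl : (b = 2 * N'' + 1 ∧ y ∈ Ideal.span ({(⟨ϖF, hϖF.mem⟩ : 𝒪[F]) ^ (N'' + 1)} : Set 𝒪[F])) ∨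
      ∃ M : ℕ, 1 ≤ M ∧ M ≤ N'' ∧ b = 2 * M ∧ y ∈ Ideal.span ({(⟨ϖF, hϖF.mem⟩ : 𝒪[F]) ^ M} : Set 𝒪[F]) ∧
        y ∉ Ideal.span ({(⟨ϖF, hϖF.mem⟩ : 𝒪[F]) ^ (M + 1)} : Set 𝒪[F])) :
    ∃ u' p' q' : 𝒪[E],
      ((Polynomial.eval₂RingHom (RingHom.prod (RingHom.id 𝒪[E]) j) ((u', j p' + j q' * θ) : 𝒪[E] × O₁)).range : Set (𝒪[E] × O₁)) =
        {z : 𝒪[E] × O₁ | ∃ b₀ c₀ : 𝒪[E], z.2 = j b₀ + j c₀ * (j ((⟨ϖ, hϖ.mem⟩ : 𝒪[E]) ^ N'') * θ) ∧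
          z.1 - (b₀ + c₀ * ιO y) ∈ Ideal.span {(⟨ϖ, hϖ.mem⟩ : 𝒪[E]) ^ b}} ∧
      ((u', j p' + j q' * θ) : 𝒪[E] × O₁) * RingHom.prodMap σO σ₁ (u', j p' + j q' * θ) = 1 ∧
      (Units.map ((Polynomial.eval₂RingHom (RingHom.prod (RingHom.id 𝒪[E]) j) ((u', j p' + j q' * θ) : 𝒪[E] × O₁)).range.subtype :
          (Polynomial.eval₂RingHom (RingHom.prod (RingHom.id 𝒪[E]) j) ((u', j p' + j q' * θ) : 𝒪[E] × O₁)).range →* 𝒪[E] × O₁)).range.relIndex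
        ((Units.map ((Polynomial.eval₂RingHom (RingHom.prod (RingHom.id 𝒪[E]) j) ((u', j p' + j q' * θ) : 𝒪[E] × O₁)).range.subtype :
          (Polynomial.eval₂RingHom (RingHom.prod (RingHom.id 𝒪[E]) j) ((u', j p' + j q' * θ) : 𝒪[E] × O₁)).range →* 𝒪[E] × O₁)).range.comap
          (MonoidHom.id (𝒪[E] × O₁)ˣ * Units.map (RingHom.prodMap σO σ₁ : 𝒪[E] × O₁ →* 𝒪[E] × O₁))) =
        (Nat.card 𝓀[F] + 1) * Nat.card 𝓀[F] ^ (N'' + b - 1) := by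
  obtain ⟨u', p', q', t', D', hxstar, hu1, hp1, hχ1, hlam2, hN, hn, hset⟩ :=
    exists_unitary_generator_glued ιO σO j σ₁ θ hσσ hσι hιu hσ₁j hσ₁θ hθ haF hk₀ hcoord hϖF hϖ hιϖ hk₁ hξ hnormEb hlvl
  have hb1 : 1 ≤ b := by rcases hlvl with ⟨hb, -⟩ | ⟨M, hM1, -, hb, -⟩ <;> omega
  refine ⟨u', p', q', hset, hxstar, ?_⟩
  exact relIndex_units_comap_norm_eq_eisenstein ιO σO j σ₁ θ u' hσσ hσι hfixO hιinj hιu hσ₁j hσ₁θ hθ haF hk₀ hcoord rfl hlam2 hu1 hp1 hχ1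
    hxstar hnormE hnorm₁ hϖF hϖ hιϖ hn hN hq hξ (by omega)


end Literature.NumberTheory.Automorphic

end
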